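import Summits.Parity.GeneralizedHardyLittlewood.Theorems.GreenTaoLevelTwoGITwoCyclicInverseBohrDoubling
import Mathlib.Analysis.SpecialFunctions.Log.Basic
import Literature.NumberTheory.Sieve.LinearEquationsInPrimesSieveTau

/-!
# Route `GreenTaoLevelTwo`, crux `GITwo` (stmt-Parity-21275), line `birth`, stub `stub_cyclicInverse`:
# preliminaries for regular Bohr sets (GT08a arXiv Def. 16 / Lemma 36)

Twenty-second helper file toward the XL stub `stub_cyclicInverse` (B. Green, T. Tao, *An inverse
theorem for the Gowers `U³(G)` norm*, arXiv:math/0503014, Thm. 68 = PEMS 51 (2008) Thm. 12.8).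
Block B5 of the printed proof: arXiv Def. 16 (a Bohr set `B(S,ρ)` of rank `d = #S` is REGULAR when
`(1 − 100d|κ|) #B(S,ρ) ≤ #B(S,(1+κ)ρ) ≤ (1 + 100d|κ|) #B(S,ρ)` for all `|κ| ≤ 1/(100d)`) and arXiv
Lemma 36 (for every `ε > 0` some `ρ ∈ [ε, 2ε]` makes `B(S,ρ)` regular; file `…BohrRegular`).
The paper proves Lemma 36 with the Vitali covering lemma applied to `a ↦ log #B(S, 2^a ε)`; the
sibling file gives a DISCRETE proof on the grid `t_k = k h` of `[0, log 2]`, whose two ingredients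
are landed here, def-free:

* `card_filter_Icc_le_of_forall_exists_gt` / `card_filter_Icc_le_of_forall_exists_lt` — for a
  monotone sequence `φ : ℕ → ℝ` and `K > 0`, the grid points `i` admitting some `j > i`
  (resp. `j < i`) with `φ j − φ i > K (j − i)` (resp. `φ i − φ j > K (i − j)`) are at most
  `(φ n − φ 0)/K` in number (greedy disjoint intervals — the discrete one-sided
  Hardy–Littlewood maximal inequality for monotone functions);
* `card_bohr_mono`, `one_le_card_bohr` — monotonicity in the radius and `0 ∈ B(S,ρ)`;
* `regular_of_exp_control` — from the exponential-scale control
  `#B(ρe^{s}) ≤ e^{50 d s} #B(ρ)`, `e^{-50 d s} #B(ρ) ≤ #B(ρ e^{-s})` (`0 ≤ s ≤ 1/(50d)`) to the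
  two-sided inequality of arXiv Def. 16 (`|log(1+κ)| ≤ 2|κ|`, `e^u ≤ 1 + 2u` from the tree's
  `Literature.NumberTheory.Sieve.exp_le_one_add_two_mul`, `e^{-u} ≥ 1 − u`).

References: [GreenTao2008U3Inverse] arXiv:math/0503014, Def. 16 and Lemma 36; J. Bourgain, *On
triples in arithmetic progression*, GAFA 9 (1999), §3; T. Tao, V. Vu, *Additive Combinatorics*,
Lemma 4.25.
-/

noncomputable section

namespace Summit.Parity.GeneralizedHardyLittlewood.GreenTaoLevelTwoGITwoCyclicInverse

open Finset

/-! ### Two counting lemmas for monotone sequences -/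

/-- Greedy disjoint intervals, rightward: if every `i` with `P i` (`a ≤ i ≤ n`) has some `j ∈ (i, n]`
with `φ j − φ i > K (j − i)`, then `K · #{i ∈ [a, n] : P i} ≤ φ n − φ a` (`φ` monotone). [folklore] -/
theorem card_filter_Icc_le_of_forall_exists_gt {φ : ℕ → ℝ} (hφ : Monotone φ) {K : ℝ} (hK : 0 < K)
    (n : ℕ) (P : ℕ → Prop) [DecidablePred P]
    (hP : ∀ i, P i → i ≤ n → ∃ j, i < j ∧ j ≤ n ∧ K * ((j : ℝ) - i) < φ j - φ i)
    {a : ℕ} (ha : a ≤ n) : K * #{i ∈ Icc a n | P i} ≤ φ n - φ a := by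
  suffices H : ∀ m a, n - a = m → a ≤ n → K * #{i ∈ Icc a n | P i} ≤ φ n - φ a from H _ a rfl ha
  intro m
  induction' m using Nat.strong_induction_on with m ih
  intro a hm ha
  by_cases hPa : P a
  · obtain ⟨j, haj, hjn, hj⟩ := hP a hPa ha
    have hsub : ({i ∈ Icc a n | P i} : Finset ℕ) ⊆ Ico a j ∪ {i ∈ Icc j n | P i} := by
      intro i hi
      rw [mem_filter, mem_Icc] at hi
      rw [mem_union, mem_Ico, mem_filter, mem_Icc]
      by_cases hij : i < j
      · exact Or.inl ⟨hi.1.1, hij⟩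
      · exact Or.inr ⟨⟨not_lt.mp hij, hi.1.2⟩, hi.2⟩
    have hIH := ih (n - j) (by omega) j rfl hjn
    have h1 : (#{i ∈ Icc a n | P i} : ℝ) ≤ ((j : ℝ) - a) + #{i ∈ Icc j n | P i} := by
      have h := (card_le_card hsub).trans (card_union_le _ _)
      rw [Nat.card_Ico] at h
      have h' : (#{i ∈ Icc a n | P i} : ℝ) ≤ ((j - a : ℕ) : ℝ) + #{i ∈ Icc j n | P i} := by
        exact_mod_cast h
      rwa [Nat.cast_sub haj.le] at h'
    calc K * #{i ∈ Icc a n | P i} ≤ K * (((j : ℝ) - a) + #{i ∈ Icc j n | P i}) := by gcongr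
      _ = K * ((j : ℝ) - a) + K * #{i ∈ Icc j n | P i} := by ring
      _ ≤ (φ j - φ a) + (φ n - φ j) := by linarith
      _ = φ n - φ a := by ring
  · rcases Nat.eq_or_lt_of_le ha with rfl | hlt
    · have : ({i ∈ Icc a a | P i} : Finset ℕ) = ∅ := by
        rw [filter_eq_empty_iff]
        intro i hi
        rw [mem_Icc] at hi
        have : i = a := le_antisymm hi.2 hi.1
        rw [this]; exact hPa
      rw [this, card_empty, Nat.cast_zero, mul_zero, sub_self]
    · have hsub : ({i ∈ Icc a n | P i} : Finset ℕ) ⊆ {i ∈ Icc (a + 1) n | P i} := by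
        intro i hi
        rw [mem_filter, mem_Icc] at hi
        rw [mem_filter, mem_Icc]
        refine ⟨⟨?_, hi.1.2⟩, hi.2⟩
        rcases Nat.eq_or_lt_of_le hi.1.1 with h | h
        · exact absurd (h ▸ hi.2) hPa
        · exact h
      have hIH := ih (n - (a + 1)) (by omega) (a + 1) rfl hlt
      have hmono : φ a ≤ φ (a + 1) := hφ (Nat.le_succ a)
      have h1 : (#{i ∈ Icc a n | P i} : ℝ) ≤ #{i ∈ Icc (a + 1) n | P i} := by
        exact_mod_cast card_le_card hsub
      calc K * #{i ∈ Icc a n | P i} ≤ K * #{i ∈ Icc (a + 1) n | P i} := by gcongr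
        _ ≤ φ n - φ (a + 1) := hIH
        _ ≤ φ n - φ a := by linarith

/-- Greedy disjoint intervals, leftward: if every `i` with `P i` has some `j < i` with
`φ i − φ j > K (i − j)`, then `K · #{i ∈ [0, b] : P i} ≤ φ b − φ 0` (`φ` monotone). [folklore] -/
theorem card_filter_Icc_le_of_forall_exists_lt {φ : ℕ → ℝ} (hφ : Monotone φ) {K : ℝ} (hK : 0 < K)
    (P : ℕ → Prop) [DecidablePred P]
    (hP : ∀ i, P i → ∃ j, j < i ∧ K * ((i : ℝ) - j) < φ i - φ j) (b : ℕ) :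
    K * #{i ∈ Icc 0 b | P i} ≤ φ b - φ 0 := by
  induction' b using Nat.strong_induction_on with b ih
  by_cases hPb : P b
  · obtain ⟨j, hjb, hj⟩ := hP b hPb
    have hsub : ({i ∈ Icc 0 b | P i} : Finset ℕ) ⊆ {i ∈ Icc 0 j | P i} ∪ Ioc j b := by
      intro i hi
      rw [mem_filter, mem_Icc] at hi
      rw [mem_union, mem_Ioc, mem_filter, mem_Icc]
      by_cases hij : j < i
      · exact Or.inr ⟨hij, hi.1.2⟩
      · exact Or.inl ⟨⟨hi.1.1, not_lt.mp hij⟩, hi.2⟩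
    have hIH := ih j hjb
    have h1 : (#{i ∈ Icc 0 b | P i} : ℝ) ≤ #{i ∈ Icc 0 j | P i} + ((b : ℝ) - j) := by
      have h := (card_le_card hsub).trans (card_union_le _ _)
      rw [Nat.card_Ioc] at h
      have h' : (#{i ∈ Icc 0 b | P i} : ℝ) ≤ #{i ∈ Icc 0 j | P i} + ((b - j : ℕ) : ℝ) := by
        exact_mod_cast h
      rwa [Nat.cast_sub hjb.le] at h'
    calc K * #{i ∈ Icc 0 b | P i} ≤ K * (#{i ∈ Icc 0 j | P i} + ((b : ℝ) - j)) := by gcongr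
      _ = K * #{i ∈ Icc 0 j | P i} + K * ((b : ℝ) - j) := by ring
      _ ≤ (φ j - φ 0) + (φ b - φ j) := by linarith
      _ = φ b - φ 0 := by ring
  · rcases Nat.eq_zero_or_pos b with rfl | hpos
    · have : ({i ∈ Icc 0 0 | P i} : Finset ℕ) = ∅ := by
        rw [filter_eq_empty_iff]
        intro i hi
        rw [mem_Icc] at hi
        have : i = 0 := Nat.le_zero.mp hi.2
        rw [this]; exact hPb
      rw [this, card_empty, Nat.cast_zero, mul_zero, sub_self]
    · obtain ⟨b', rfl⟩ : ∃ b', b = b' + 1 := ⟨b - 1, by omega⟩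
      have hsub : ({i ∈ Icc 0 (b' + 1) | P i} : Finset ℕ) ⊆ {i ∈ Icc 0 b' | P i} := by
        intro i hi
        rw [mem_filter, mem_Icc] at hi
        rw [mem_filter, mem_Icc]
        refine ⟨⟨hi.1.1, ?_⟩, hi.2⟩
        rcases Nat.eq_or_lt_of_le hi.1.2 with h | h
        · exact absurd (h ▸ hi.2) hPb
        · exact Nat.lt_succ_iff.mp h
      have hIH := ih b' (Nat.lt_succ_self b')
      have hmono : φ b' ≤ φ (b' + 1) := hφ (Nat.le_succ b')
      have h1 : (#{i ∈ Icc 0 (b' + 1) | P i} : ℝ) ≤ #{i ∈ Icc 0 b' | P i} := by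
        exact_mod_cast card_le_card hsub
      calc K * #{i ∈ Icc 0 (b' + 1) | P i} ≤ K * #{i ∈ Icc 0 b' | P i} := by gcongr
        _ ≤ φ b' - φ 0 := hIH
        _ ≤ φ (b' + 1) - φ 0 := by linarith

/-! ### Bohr sets: monotonicity, the origin, and the regularity conversion -/

variable {N : ℕ} [NeZero N]

/-- `B(S, r) ⊆ B(S, r')` for `r ≤ r'`. [folklore] -/
theorem card_bohr_mono (S : Finset (ZMod N)) {r r' : ℝ} (h : r ≤ r') :
    #{x : ZMod N | ∀ ξ ∈ S, ‖ZMod.toAddCircle (x * ξ)‖ < r} ≤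
      #{x : ZMod N | ∀ ξ ∈ S, ‖ZMod.toAddCircle (x * ξ)‖ < r'} := by
  refine card_le_card fun x hx => ?_
  rw [mem_filter] at hx ⊢
  exact ⟨hx.1, fun ξ hξ => (hx.2 ξ hξ).trans_le h⟩

/-- `0 ∈ B(S, r)` for `r > 0`, so `#B(S, r) ≥ 1`. [folklore] -/
theorem one_le_card_bohr (S : Finset (ZMod N)) {r : ℝ} (hr : 0 < r) :
    1 ≤ #{x : ZMod N | ∀ ξ ∈ S, ‖ZMod.toAddCircle (x * ξ)‖ < r} := by
  rw [Nat.one_le_iff_ne_zero, ← Nat.pos_iff_ne_zero, card_pos]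
  refine ⟨0, ?_⟩
  rw [mem_filter]
  refine ⟨mem_univ _, fun ξ _ => ?_⟩
  rw [zero_mul, map_zero, norm_zero]; exact hr

/-- From two-sided exponential-scale control to arXiv Def. 16: if `G : ℝ → ℝ` is monotone with
`G ρ ≥ 0`, `d ≥ 1`, and for all `0 ≤ s ≤ 1/(50d)` one has `G(ρ e^s) ≤ e^{50 d s} G(ρ)` and
`e^{−50 d s} G(ρ) ≤ G(ρ e^{−s})`, then `(1 − 100d|κ|) G(ρ) ≤ G((1+κ)ρ) ≤ (1 + 100d|κ|) G(ρ)` for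
`|κ| ≤ 1/(100d)`. [folklore] -/
theorem regular_of_exp_control {G : ℝ → ℝ} (hG : Monotone G) {ρ d : ℝ} (hρ : 0 < ρ) (hd : 1 ≤ d)
    (hGρ : 0 ≤ G ρ)
    (hU : ∀ s : ℝ, 0 ≤ s → s ≤ 1 / (50 * d) → G (ρ * Real.exp s) ≤ Real.exp (50 * d * s) * G ρ)
    (hL : ∀ s : ℝ, 0 ≤ s → s ≤ 1 / (50 * d) → Real.exp (-(50 * d * s)) * G ρ ≤ G (ρ * Real.exp (-s)))
    {κ : ℝ} (hκ : |κ| ≤ 1 / (100 * d)) :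
    (1 - 100 * d * |κ|) * G ρ ≤ G ((1 + κ) * ρ) ∧ G ((1 + κ) * ρ) ≤ (1 + 100 * d * |κ|) * G ρ := by
  have hd0 : 0 < d := by linarith
  have h50 : (0 : ℝ) < 1 / (50 * d) := by positivity
  have hκhalf : |κ| ≤ 1 / 2 := hκ.trans (by
    rw [div_le_div_iff₀ (by positivity) (by norm_num)]; linarith)
  rcases le_or_gt 0 κ with hk | hk
  · -- `κ ≥ 0`: the lower bound is monotonicity, the upper bound is `hU` at `s = log (1 + κ)`
    rw [abs_of_nonneg hk] at hκ hκhalf ⊢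
    have hmono : G ρ ≤ G ((1 + κ) * ρ) := hG (by nlinarith)
    refine ⟨?_, ?_⟩
    · calc (1 - 100 * d * κ) * G ρ ≤ 1 * G ρ := by
            apply mul_le_mul_of_nonneg_right _ hGρ; nlinarith
        _ = G ρ := one_mul _
        _ ≤ _ := hmono
    · set s := Real.log (1 + κ) with hs
      have hs0 : 0 ≤ s := Real.log_nonneg (by linarith)
      have hsκ : s ≤ κ := by
        have := Real.log_le_sub_one_of_pos (x := 1 + κ) (by linarith)
        linarith
      have hs1 : s ≤ 1 / (50 * d) := hsκ.trans (hκ.trans (by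
        rw [div_le_div_iff₀ (by positivity) (by positivity)]; nlinarith))
      have hexp : (1 + κ) * ρ = ρ * Real.exp s := by
        rw [hs, Real.exp_log (by linarith), mul_comm]
      rw [hexp]
      refine (hU s hs0 hs1).trans ?_
      apply mul_le_mul_of_nonneg_right _ hGρ
      have hu1 : 50 * d * s ≤ 50 * d * κ := by nlinarith
      have hu2 : 50 * d * κ ≤ 1 / 2 := by
        have := hκ
        rw [le_div_iff₀ (by positivity)] at this
        nlinarith
      calc Real.exp (50 * d * s) ≤ Real.exp (50 * d * κ) := Real.exp_le_exp.mpr hu1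
        _ ≤ 1 + 2 * (50 * d * κ) :=
            Literature.NumberTheory.Sieve.exp_le_one_add_two_mul (by positivity) (by linarith)
        _ = 1 + 100 * d * κ := by ring
  · -- `κ < 0`: the upper bound is monotonicity, the lower bound is `hL` at `s = -log (1 + κ)`
    have hk' : |κ| = -κ := abs_of_neg hk
    rw [hk'] at hκ hκhalf ⊢
    have hmono : G ((1 + κ) * ρ) ≤ G ρ := hG (by nlinarith)
    refine ⟨?_, ?_⟩
    · set s := -Real.log (1 + κ) with hs
      have h1κ : 0 < 1 + κ := by linarith
      have hs0 : 0 ≤ s := by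
        rw [hs, neg_nonneg]
        exact Real.log_nonpos h1κ.le (by linarith)
      have hsκ : s ≤ 2 * (-κ) := by
        -- `log (1+κ) ≥ 1 - 1/(1+κ) = κ/(1+κ) ≥ 2κ` for `-1/2 ≤ κ ≤ 0`
        have h := Real.one_sub_inv_le_log_of_pos h1κ
        have hinv : (1 + κ)⁻¹ ≤ 1 - 2 * κ := by
          rw [inv_le_comm₀ h1κ (by linarith), ← one_div, div_le_iff₀ (by linarith)]
          nlinarith
        rw [hs]; linarith
      have hs1 : s ≤ 1 / (50 * d) := hsκ.trans (by
        have := hκ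
        rw [le_div_iff₀ (by positivity)] at this
        rw [le_div_iff₀ (by positivity)]
        nlinarith)
      have hexp : (1 + κ) * ρ = ρ * Real.exp (-s) := by
        rw [hs, neg_neg, Real.exp_log h1κ, mul_comm]
      rw [hexp]
      refine le_trans ?_ (hL s hs0 hs1)
      apply mul_le_mul_of_nonneg_right _ hGρ
      have h3 : 1 - 50 * d * s ≤ Real.exp (-(50 * d * s)) := by
        have := Real.add_one_le_exp (-(50 * d * s)); linarith
      refine le_trans ?_ h3
      nlinarith
    · calc G ((1 + κ) * ρ) ≤ G ρ := hmono
        _ = 1 * G ρ := (one_mul _).symm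
        _ ≤ (1 + 100 * d * -κ) * G ρ := by
            apply mul_le_mul_of_nonneg_right _ hGρ; nlinarith

end Summit.Parity.GeneralizedHardyLittlewood.GreenTaoLevelTwoGITwoCyclicInverse
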